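import Literature.MathematicalPhysics.QuantumFieldTheory.Balaban1983to89.B1Eq324BenfattoSect5PavementChain
import Literature.MathematicalPhysics.QuantumFieldTheory.Balaban1983to89.B1Eq324BenfattoSect5UpperStep
import Literature.MathematicalPhysics.QuantumFieldTheory.Balaban1983to89.B1Eq324BenfattoCondTranslation
import HarnessLib

/-!
# `Balaban1983to89.B1Eq324BenfattoSect5PavementChainUpper` — [BenfattoEtAl1978] §5 p. 159, (5.36) → (4.6): THE UPPER CHAIN OF `d + 1` DISPLACED PAVEMENT
# STEPS UNDER `P̄ = P̂₀(·|z̄_C)` (ANY `C`), in drifting frames, with growing cut-offs «b replaced by γ⁻¹b», down to a terminal small-field VOLUME `≤ 1`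

statement-level skeleton of published theorems with citation tags; proofs where landed; nothing here is a claim about the
Yang–Mills mass gap

WHY THIS MODULE (cell `pub-ymgap`, seat `dag-n08-c` gen 19, INTENT-2; node N08 [Balaban1985UV3]; sequel of `B1Eq324BenfattoSect5PavementChain`, which
chains the LOWER steps of (4.7)).  Print, p. 159: *"(4.6) is obtained by simple modifications of (4.7). We start from (5.13), then assuming |z_Δ| ≦ b(1+d(Δ,I))
∀Δ ∈ C: [(5.12)] ≦ … (5.36) By beeing careful in attributing to the various τ the value opposite to the one chosen in the estimate (4.7) we obtain that
(5.12) can be bounded above by the r.h.s. of (5.35) with b replaced by γ⁻¹b"*.  Sibling seat dag-n08-d typed ONE such step under the conditioned law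
(`…Sect5UpperStep.upperPavementStep_cond_of_setIntegral_gamma_union`: input cut-offs `γb`, box interiors `b`, per-box UPPER bounds under the two-stage law
`P̂₀(·|ξ_{C∪Γ₁})` for the data `ξ` small on `C ∪ Γ₁` — literally the `hξ` of the per-box supplier —, outer measure `condField C z̄` for ANY finite `C` and ANY `z̄`) and the translation of the conditioned field (`…CondTranslation.integral_condField_comp_translate`).
This file chains `n` such steps in drifting frames — the conditioning datum drifts too: `C_{k+1} = C_k + τ_k`, `z̄_{k+1} = z̄_k ∘ (· − τ_k)` — with the
cut-offs GROWING, `γ·b_{k+1} = b_k`… precisely: step `k` runs at data threshold `γb_k` and box threshold `b_k`, and hands on the cut-off `b_k = γb_{k+1}`;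
after `d + 1` suitably displaced steps `J_{d+1} = ∅` (`…PavementChain.chain_eq_empty_of_sep`) and the terminal integral is a small-field volume of a
probability measure, `≤ 1`.

DICTIONARY.  As in `…PavementChain`; in addition `P̄_k = condField d α β (C_k) (z̄_k)`; `integral_cutoffBoltzmann_condField_frame` is the conditioned twin of
`…PavementChain.integral_cutoffBoltzmann_frame`.

WHAT IS PROVED (theorems only; no definition, no named fact, no `sorry`; axioms standard).
* §1 `integral_condField_frame`, ★ `integral_cutoffBoltzmann_condField_frame` (the (4.6)-integral of the datum `(J, I, A, b; C, z̄)` equals the one of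
  `(J+τ, I+τ, A(·−τ), b; C+τ, z̄∘(·−τ))`).
* §2 ★ `upperPavementStep_cond_frame` — ONE DISPLACED γ-UPPER STEP under `P̄`.
* §3 ★★ `upperPavementChainCond` (`n` steps), `integral_cutoffBoltzmann_condField_of_eq_empty`, ★★★ `upperPavementChainCond_le_exp` (THE (4.6)-SIDE DRIVER:
  `∫Π_Δχ̂^{I_0}_{γb_0}e^{H^{A_0}_{J_0}}dP̄_0 ≤ exp(Σ_{k≤d}(err₅₁₁(k) + err₅₃₄(k) + Σ_{□∈B_k}u_k(□)))`).
* §5 (4.6) MODULO THE IDENTIFICATION AND THE LEDGER: ★★★ `ineq46_of_chain` (`Ineq46` for one choice of everything — ANY conditioning values `z̄` —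
  from the upper-chain hypotheses + (O1′) per-step `Σ_□u_k(□) ≤ [cumulantSum difference] + idErr_k` + (O2′) the ledger
  `Σ_k(err₅₁₁+err₅₃₄+idErr_k) ≤ |I|·errTerm …`) — the (4.6) twin of `…Sect5CollectErrors.ineq47_of_chain`.
* §4 THE CONDITIONING SET ALONG THE CHAIN: `distToRegion_image_add`, `mem_smallFieldOn_frame`, `far_frame`, ★ `chain_far_small` (the distance condition
  «C at b³ from J» and the smallness of `z̄` on `C` propagate along the chain), ★ `disjoint_box_of_far` / `disjoint_union_corridors_shrink_of_far` (a far
  `C` misses every tessera meeting `J`: the hypothesis `hΓd` of the per-box supplier at `Γ := C ∪ Γ₁`).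

HONEST SCOPE / NOT HERE.  Structural/bookkeeping only; the per-box upper bounds and exponents `u_k(□)` (the per-box line's `perBox_condField` 5th conjunct
under `P̂₀(·|ξ_{C_k∪Γ₁})`, which needs print's distance condition «C at distance b³ from J» for its centre bound), the comparison of `Σ_kΣ_□u_k(□)` with
`[Σ_{k≤t}ℰ̂₀^T(H_J;k)/k!] + |I|·S(…)` and `b*` are NOT here.  `BasicLemmaPrinted` stays OPEN; count-neutral for N08; nothing of [Balaban1985UV3]
(41)/(47)/(5) is asserted; nothing about d = 4, the continuum, OS axioms, a mass gap or the Clay problem.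
-/

noncomputable section

open Finset MeasureTheory
open scoped BigOperators

namespace Literature.MathematicalPhysics.QuantumFieldTheory.Balaban1983to89.B1Eq324BenfattoSect5PavementChainUpper

open _root_.MeasureTheory
open Literature.MathematicalPhysics.QuantumFieldTheory.Balaban1983to89.B1Eq324BenfattoLemma
open Literature.MathematicalPhysics.QuantumFieldTheory.Balaban1983to89.B1Eq324BenfattoSect5Boxes
open Literature.MathematicalPhysics.QuantumFieldTheory.Balaban1983to89.B1Eq324BenfattoSect5Eq511
open Literature.MathematicalPhysics.QuantumFieldTheory.Balaban1983to89.B1Eq324BenfattoSect5Eq524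
open Literature.MathematicalPhysics.QuantumFieldTheory.Balaban1983to89.B1Eq324BenfattoSect5Eq534
open Literature.MathematicalPhysics.QuantumFieldTheory.Balaban1983to89.B1Eq324BenfattoSect5Eq515
open Literature.MathematicalPhysics.QuantumFieldTheory.Balaban1983to89.B1Eq324BenfattoSect5Iteration
open Literature.MathematicalPhysics.QuantumFieldTheory.Balaban1983to89.B1Eq324BenfattoSect5Termination
open Literature.MathematicalPhysics.QuantumFieldTheory.Balaban1983to89.B1Eq324BenfattoSect5PavementStep
open Literature.MathematicalPhysics.QuantumFieldTheory.Balaban1983to89.B1Eq324BenfattoSect5Eq536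
open Literature.MathematicalPhysics.QuantumFieldTheory.Balaban1983to89.B1Eq324BenfattoSect5UpperStep
open Literature.MathematicalPhysics.QuantumFieldTheory.Balaban1983to89.B1Eq324BenfattoCondTranslation (integral_condField_comp_translate)
open Literature.MathematicalPhysics.QuantumFieldTheory.Balaban1983to89.B1Eq324BenfattoTranslation (cubeDist_add_right)
open Literature.MathematicalPhysics.QuantumFieldTheory.Balaban1983to89.B1Eq324BenfattoMarkov (isProbabilityMeasure_condField)
open Literature.MathematicalPhysics.QuantumFieldTheory.Balaban1983to89.B1Eq324BenfattoSect5PavementChain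
open Literature.MathematicalPhysics.QuantumFieldTheory.Balaban1983to89.B1Eq324BenfattoSpecialisation (coefSup_nonneg)

variable {d : ℕ}

/-! ## §1  Conditioned frames: the conditioning datum drifts with the frame -/

section Frames

variable {α β : ℝ} {s D : ℕ} {κ : ℝ} {a : Coef d}

/-- **`∫ F dP̂₀(·|ζ_C) = ∫ F(z∘(·+τ)) dP̂₀(·|(ζ∘(·−τ))_{C+τ})`** — the conditioned expectation of an observable equals the conditioned expectation, for
the translated conditioning datum, of the translated observable (`…CondTranslation.integral_condField_comp_translate` read in the assembler's direction).
[cite: BenfattoEtAl1978, p.152 «P̂₀(dz|(z̄_Δ)_{Δ∈C})», §5 p.159 «displaced pavement»] -/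
theorem integral_condField_frame (hα : 0 < α) (hβ : 0 < β) (C : Finset (B1Eq324BenfattoLemma.Site d)) (ζ : B1Eq324BenfattoLemma.Site d → ℝ)
    (τ : B1Eq324BenfattoLemma.Site d) {F : (B1Eq324BenfattoLemma.Site d → ℝ) → ℝ} (hF : Measurable F) :
    ∫ z, F z ∂condField d α β C ζ =
      ∫ z, F (fun x => z (x + τ)) ∂condField d α β (C.image fun x => x + τ) (fun y => ζ (y - τ)) := by
  rw [integral_condField_comp_translate hα hβ C τ _ hF]
  simp only [add_sub_cancel_right]

/-- **THE (4.6)-INTEGRAL IS FRAME INDEPENDENT**: `∫ Π_Δχ̂^{I}_{b}Δ e^{H^A_J} dP̂₀(·|ζ_C) = ∫ Π_Δχ̂^{I+τ}_{b}Δ e^{H^{A(·−τ)}_{J+τ}} dP̂₀(·|(ζ∘(·−τ))_{C+τ})` — the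
conditioned twin of `…PavementChain.integral_cutoffBoltzmann_frame`. [cite: BenfattoEtAl1978, (4.6) p.152, §5 p.159] -/
theorem integral_cutoffBoltzmann_condField_frame (hα : 0 < α) (hβ : 0 < β) (J I C : Finset (B1Eq324BenfattoLemma.Site d))
    (ζ : B1Eq324BenfattoLemma.Site d → ℝ) (b : ℝ) (τ : B1Eq324BenfattoLemma.Site d) :
    ∫ z, cutoffBoltzmann (hamiltonian s D κ a J) I b z ∂condField d α β C ζ =
      ∫ z, cutoffBoltzmann (hamiltonian s D κ (shiftCoef a (-τ)) (J.image fun x => x + τ)) (I.image fun x => x + τ) b z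
        ∂condField d α β (C.image fun x => x + τ) (fun y => ζ (y - τ)) := by
  rw [integral_condField_frame hα hβ C ζ τ (measurable_cutoffBoltzmann_hamiltonian a J I b)]
  simp only [cutoffBoltzmann_frame]

end Frames

/-! ## §2  One displaced γ-upper step under `P̄` -/

section Step

variable {α β : ℝ} {s D : ℕ} {κ : ℝ} {L w v : ℕ} {γ A : ℝ}

/-- **ONE DISPLACED UPPER STEP UNDER `P̄ = P̂₀(·|ζ_C)`, input cut-off `γb`, box interiors `b`** — the sibling seat's
`…Sect5UpperStep.upperPavementStep_cond_of_setIntegral_gamma_union` for the datum translated by `τ` (conditioning datum included, §1): for `A` supported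
in `J ⊆ I` with the global bound `|A| ≤ A`, `L ≥ 1`, `1 ≤ w`, `v ≤ w`, `B ⊇` the tesserae meeting `J + τ`, `γ ≤ 1`, `1 ≤ b`, `1 ≤ γb`, and per-box UPPER
bounds with exponents `u_□` for the translated datum under the two-stage law `P̂₀(·|ξ_{(C+τ)∪Γ₁(B)})`, required only for the data `ξ` SMALL ON
`(C + τ) ∪ Γ₁(B)` at threshold `γb` (the `hξ` of the per-box line's `perBox_condField_appD` at `Γ := (C+τ) ∪ Γ₁(B)`):
`∫Π_Δχ̂^{I}_{γb}e^{H^A_J}dP̂₀(·|ζ_C) ≤ exp(err₅₁₁(γb) + err₅₃₄(b) + Σ_{□∈B}u_□)·∫Π_Δχ̂^{I+τ}_{b}e^{H^{(A(·−τ))|Γ̄₁}_{(J+τ)∩Γ̄₁}}dP̂₀(·|(ζ∘(·−τ))_{C+τ})`.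
[cite: BenfattoEtAl1978, §5 (5.36) p.159 «with b replaced by γ⁻¹b», (4.6) p.152] -/
theorem upperPavementStep_cond_frame (hα : 0 < α) (hβ : 0 < β) (hκ : 0 < κ) {a : Coef d} {J I : Finset (B1Eq324BenfattoLemma.Site d)}
    (hJ : CoefSupportedIn a J) (hA0 : 0 ≤ A)
    (hA : ∀ (p : ℕ) (Δ : Fin p → B1Eq324BenfattoLemma.Site d) (n : Fin p → ℕ), |a p Δ n| ≤ A)
    (hJI : J ⊆ I) (hL : 0 < L) (hw : 1 ≤ w) (hv : v ≤ w) (τ : B1Eq324BenfattoLemma.Site d) {B : Finset (B1Eq324BenfattoLemma.Site d)}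
    (hB : (J.image fun x => x + τ).image (boxIndex L) ⊆ B) (hγ : γ ≤ 1) {b : ℝ} (hb : 1 ≤ b) (hγb : 1 ≤ γ * b)
    (C : Finset (B1Eq324BenfattoLemma.Site d)) (ζ : B1Eq324BenfattoLemma.Site d → ℝ) (u : B1Eq324BenfattoLemma.Site d → ℝ)
    (hbox : ∀ m ∈ B, ∀ ξ : B1Eq324BenfattoLemma.Site d → ℝ,
      ξ ∈ smallFieldOn (((C.image fun x => x + τ) ∪ corridors L w B : Finset (B1Eq324BenfattoLemma.Site d)) :
        Set (B1Eq324BenfattoLemma.Site d)) (I.image fun x => x + τ) (γ * b) →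
      ∫ z in smallFieldOn (shrink L m w : Set (B1Eq324BenfattoLemma.Site d)) (I.image fun x => x + τ) b,
          Real.exp (psiBox s D κ (shiftCoef a (-τ)) L w m z) ∂condField d α β ((C.image fun x => x + τ) ∪ corridors L w B) ξ
        ≤ Real.exp (u m) * ∫ z in smallFieldOn (shrink L m w : Set (B1Eq324BenfattoLemma.Site d)) (I.image fun x => x + τ) b,
          Real.exp (psi1p s D κ (shiftCoef a (-τ)) L w v m z + psi2 s D κ (shiftCoef a (-τ)) L w m z)
            ∂condField d α β ((C.image fun x => x + τ) ∪ corridors L w B) ξ) :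
    ∫ z, cutoffBoltzmann (hamiltonian s D κ a J) I (γ * b) z ∂condField d α β C ζ ≤
      Real.exp (s1Const s D d κ * A * (γ * b) ^ D * Real.exp (-(κ / 4 * w)) * J.card
        + s1Const s D d κ * A * b ^ D *
          (Real.exp (-(κ / 4 * w)) * (corridorsBar L w v B).card + Real.exp (-(κ / 4 * v)) * (B.card * (L : ℝ) ^ d))
        + ∑ m ∈ B, u m) *
        ∫ z, cutoffBoltzmann (hamiltonian s D κ (restrictCoef (shiftCoef a (-τ)) (corridorsBar L w v B))
          ((J.image fun x => x + τ) ∩ corridorsBar L w v B)) (I.image fun x => x + τ) b z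
          ∂condField d α β (C.image fun x => x + τ) (fun y => ζ (y - τ)) := by
  rw [integral_cutoffBoltzmann_condField_frame hα hβ J I C ζ (γ * b) τ]
  have hcard : ((J.image fun x => x + τ).card : ℝ) = J.card := by
    rw [Finset.card_image_of_injective _ (add_left_injective τ)]
  rw [← hcard]
  exact upperPavementStep_cond_of_setIntegral_gamma_union hα hβ hκ (coefSupportedIn_frame hJ τ) hA0 (C.image fun x => x + τ) (fun y => ζ (y - τ))
    (fun p _ Δ _ n _ => abs_shiftCoef_neg_le hA τ p Δ n) (Finset.image_subset_image hJI) hL hw hv hB hγ hb hγb u hbox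

end Step

/-! ## §3  The upper chain under `P̄`: `n` displaced steps with drifting conditioning datum and growing cut-offs -/

section Chain

variable {α β : ℝ} {s D : ℕ} {κ : ℝ} {L w v : ℕ} {γ A : ℝ}

/-- **THE (4.6) CHAIN — `n` DISPLACED UPPER STEPS UNDER `P̄`** («(5.12) can be bounded above by the r.h.s. of (5.35) with b replaced by γ⁻¹b», p. 159, iterated):
for ANY sequences `J_k ⊆ I_k`, `B_k`, `A_k`, conditioning data `(C_k, z̄_k)`, box cut-offs `b_k` and displacements `τ_k` obeying the recursion
`J_{k+1} = (J_k + τ_k) ∩ Γ̄₁(B_k)`, `I_{k+1} = I_k + τ_k`, `A_{k+1} = (A_k(· − τ_k))|_{Γ̄₁(B_k)}`, `C_{k+1} = C_k + τ_k`, `z̄_{k+1} = z̄_k∘(· − τ_k)`, `γ·b_{k+1} = b_k`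
(hypotheses), with `A_0` supported in `J_0` and globally bounded by `A ≥ 0`, `B_k ⊇` the tesserae meeting `J_k + τ_k`, `1 ≤ γb_k`, and per-box UPPER
bounds with exponents `u_k(□)` under `P̂₀(·|ξ_{C_{k+1}∪Γ₁(B_k)})` for the `ξ` small on `C_{k+1} ∪ Γ₁(B_k)` at threshold `γb_k`:
`∫Π_Δχ̂^{I_0}_{γb_0}e^{H^{A_0}_{J_0}}dP̄_0 ≤ exp(Σ_{k<n}(err₅₁₁(k) + err₅₃₄(k) + Σ_{□∈B_k}u_k(□)))·∫Π_Δχ̂^{I_n}_{γb_n}e^{H^{A_n}_{J_n}}dP̄_n`, `P̄_k = P̂₀(·|(z̄_k)_{C_k})`.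
[cite: BenfattoEtAl1978, §5 (5.36) p.159, (4.6) p.152] -/
theorem upperPavementChainCond (hα : 0 < α) (hβ : 0 < β) (hκ : 0 < κ) (hL : 0 < L) (hw : 1 ≤ w) (hv : v ≤ w) (hγ : γ ≤ 1) (hA0 : 0 ≤ A)
    {Js Is Bs Cs : ℕ → Finset (B1Eq324BenfattoLemma.Site d)} {as : ℕ → Coef d} {zs : ℕ → B1Eq324BenfattoLemma.Site d → ℝ} {bs : ℕ → ℝ}
    {τ : ℕ → B1Eq324BenfattoLemma.Site d} {n : ℕ}
    (hsupp : CoefSupportedIn (as 0) (Js 0))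
    (hA : ∀ (p : ℕ) (Δ : Fin p → B1Eq324BenfattoLemma.Site d) (nn : Fin p → ℕ), |as 0 p Δ nn| ≤ A) (hJI : Js 0 ⊆ Is 0)
    (hrecJ : ∀ k < n, Js (k + 1) = (Js k).image (fun x => x + τ k) ∩ corridorsBar L w v (Bs k))
    (hrecI : ∀ k < n, Is (k + 1) = (Is k).image fun x => x + τ k)
    (hreca : ∀ k < n, as (k + 1) = restrictCoef (shiftCoef (as k) (-τ k)) (corridorsBar L w v (Bs k)))
    (hrecC : ∀ k < n, Cs (k + 1) = (Cs k).image fun x => x + τ k)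
    (hrecz : ∀ k < n, zs (k + 1) = fun y => zs k (y - τ k))
    (hrecb : ∀ k < n, γ * bs (k + 1) = bs k) (hb : ∀ k < n, 1 ≤ bs k) (hγb : ∀ k < n, 1 ≤ γ * bs k)
    (hB : ∀ k < n, ((Js k).image fun x => x + τ k).image (boxIndex L) ⊆ Bs k)
    (u : ℕ → B1Eq324BenfattoLemma.Site d → ℝ)
    (hbox : ∀ k < n, ∀ m ∈ Bs k, ∀ ξ : B1Eq324BenfattoLemma.Site d → ℝ,
      ξ ∈ smallFieldOn ((((Cs k).image fun x => x + τ k) ∪ corridors L w (Bs k) : Finset (B1Eq324BenfattoLemma.Site d)) :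
        Set (B1Eq324BenfattoLemma.Site d)) ((Is k).image fun x => x + τ k) (γ * bs k) →
      ∫ z in smallFieldOn (shrink L m w : Set (B1Eq324BenfattoLemma.Site d)) ((Is k).image fun x => x + τ k) (bs k),
          Real.exp (psiBox s D κ (shiftCoef (as k) (-τ k)) L w m z)
            ∂condField d α β (((Cs k).image fun x => x + τ k) ∪ corridors L w (Bs k)) ξ
        ≤ Real.exp (u k m) * ∫ z in smallFieldOn (shrink L m w : Set (B1Eq324BenfattoLemma.Site d)) ((Is k).image fun x => x + τ k) (bs k),
          Real.exp (psi1p s D κ (shiftCoef (as k) (-τ k)) L w v m z + psi2 s D κ (shiftCoef (as k) (-τ k)) L w m z)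
            ∂condField d α β (((Cs k).image fun x => x + τ k) ∪ corridors L w (Bs k)) ξ) :
    ∫ z, cutoffBoltzmann (hamiltonian s D κ (as 0) (Js 0)) (Is 0) (γ * bs 0) z ∂condField d α β (Cs 0) (zs 0) ≤
      Real.exp (∑ k ∈ Finset.range n,
          (s1Const s D d κ * A * (γ * bs k) ^ D * Real.exp (-(κ / 4 * w)) * (Js k).card
            + s1Const s D d κ * A * bs k ^ D *
              (Real.exp (-(κ / 4 * w)) * (corridorsBar L w v (Bs k)).card + Real.exp (-(κ / 4 * v)) * ((Bs k).card * (L : ℝ) ^ d))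
            + ∑ m ∈ Bs k, u k m)) *
        ∫ z, cutoffBoltzmann (hamiltonian s D κ (as n) (Js n)) (Is n) (γ * bs n) z ∂condField d α β (Cs n) (zs n) := by
  have hinv := chain_invariants hsupp hA hJI hrecJ hrecI hreca (n := n)
  refine le_exp_sum_mul_of_steps
    (fun k => ∫ z, cutoffBoltzmann (hamiltonian s D κ (as k) (Js k)) (Is k) (γ * bs k) z ∂condField d α β (Cs k) (zs k))
    (fun k => s1Const s D d κ * A * (γ * bs k) ^ D * Real.exp (-(κ / 4 * w)) * (Js k).card
            + s1Const s D d κ * A * bs k ^ D *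
              (Real.exp (-(κ / 4 * w)) * (corridorsBar L w v (Bs k)).card + Real.exp (-(κ / 4 * v)) * ((Bs k).card * (L : ℝ) ^ d))
            + ∑ m ∈ Bs k, u k m) n fun k hk => ?_
  obtain ⟨h1, h2, h3, -⟩ := hinv k hk.le
  have hstep := upperPavementStep_cond_frame hα hβ hκ h1 hA0 h2 h3 hL hw hv (τ k) (hB k hk) hγ (hb k hk) (hγb k hk) (Cs k) (zs k) (u k)
    (hbox k hk) (s := s) (D := D)
  rw [hrecJ k hk, hrecI k hk, hreca k hk, hrecC k hk, hrecz k hk, hrecb k hk]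
  exact hstep

/-- **The terminal conditioned integral**: when `J_n = ∅` the (4.6)-integral IS the small-field volume `P̄_n.real(Π_Δχ̂^{I_n}_{c})`.
[cite: BenfattoEtAl1978, §5 p.154 «the trivial case H_J = 0», (4.6) p.152] -/
theorem integral_cutoffBoltzmann_condField_of_eq_empty {a : Coef d} {J : Finset (B1Eq324BenfattoLemma.Site d)} (hJ : J = ∅)
    (I C : Finset (B1Eq324BenfattoLemma.Site d)) (ζ : B1Eq324BenfattoLemma.Site d → ℝ) (c : ℝ) :
    ∫ z, cutoffBoltzmann (hamiltonian s D κ a J) I c z ∂condField d α β C ζ = (condField d α β C ζ).real (smallFieldSet I c) := by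
  subst hJ
  have h0 : hamiltonian s D κ a (∅ : Finset (B1Eq324BenfattoLemma.Site d)) = fun _ => 0 := funext fun z => hamiltonian_empty a z
  rw [h0]
  exact Literature.MathematicalPhysics.QuantumFieldTheory.Balaban1983to89.B1Eq324BenfattoSpecialisation.integral_cutoffBoltzmann_zero _ I c

/-- **THE (4.6)-SIDE DRIVER UNDER `P̄`** — after `d + 1` suitably displaced steps (`…PavementChain.chain_eq_empty_of_sep`) the terminal conditioned
integral is a small-field VOLUME of the probability measure `P̄_{d+1}`, hence `≤ 1`:
`∫Π_Δχ̂^{I_0}_{γb_0}e^{H^{A_0}_{J_0}}dP̂₀(·|(z̄_0)_{C_0}) ≤ exp(Σ_{k≤d}(err₅₁₁(k) + err₅₃₄(k) + Σ_{□∈B_k}u_k(□)))` with the per-box exponents and errors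
displayed. [cite: BenfattoEtAl1978, §5 (5.36) p.159, (4.6) p.152] -/
theorem upperPavementChainCond_le_exp (hα : 0 < α) (hβ : 0 < β) (hκ : 0 < κ) (hL : 0 < L) (hw : 1 ≤ w) (hv : v ≤ w) (hγ : γ ≤ 1)
    (hA0 : 0 ≤ A)
    {Js Is Bs Cs : ℕ → Finset (B1Eq324BenfattoLemma.Site d)} {as : ℕ → Coef d} {zs : ℕ → B1Eq324BenfattoLemma.Site d → ℝ} {bs : ℕ → ℝ}
    {τ : ℕ → B1Eq324BenfattoLemma.Site d}
    (hsupp : CoefSupportedIn (as 0) (Js 0))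
    (hA : ∀ (p : ℕ) (Δ : Fin p → B1Eq324BenfattoLemma.Site d) (nn : Fin p → ℕ), |as 0 p Δ nn| ≤ A) (hJI : Js 0 ⊆ Is 0)
    (hrecJ : ∀ k < d + 1, Js (k + 1) = (Js k).image (fun x => x + τ k) ∩ corridorsBar L w v (Bs k))
    (hrecI : ∀ k < d + 1, Is (k + 1) = (Is k).image fun x => x + τ k)
    (hreca : ∀ k < d + 1, as (k + 1) = restrictCoef (shiftCoef (as k) (-τ k)) (corridorsBar L w v (Bs k)))
    (hrecC : ∀ k < d + 1, Cs (k + 1) = (Cs k).image fun x => x + τ k)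
    (hrecz : ∀ k < d + 1, zs (k + 1) = fun y => zs k (y - τ k))
    (hrecb : ∀ k < d + 1, γ * bs (k + 1) = bs k) (hb : ∀ k < d + 1, 1 ≤ bs k) (hγb : ∀ k < d + 1, 1 ≤ γ * bs k)
    (hB : ∀ k < d + 1, ((Js k).image fun x => x + τ k).image (boxIndex L) ⊆ Bs k)
    (u : ℕ → B1Eq324BenfattoLemma.Site d → ℝ)
    (hbox : ∀ k < d + 1, ∀ m ∈ Bs k, ∀ ξ : B1Eq324BenfattoLemma.Site d → ℝ,
      ξ ∈ smallFieldOn ((((Cs k).image fun x => x + τ k) ∪ corridors L w (Bs k) : Finset (B1Eq324BenfattoLemma.Site d)) :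
        Set (B1Eq324BenfattoLemma.Site d)) ((Is k).image fun x => x + τ k) (γ * bs k) →
      ∫ z in smallFieldOn (shrink L m w : Set (B1Eq324BenfattoLemma.Site d)) ((Is k).image fun x => x + τ k) (bs k),
          Real.exp (psiBox s D κ (shiftCoef (as k) (-τ k)) L w m z)
            ∂condField d α β (((Cs k).image fun x => x + τ k) ∪ corridors L w (Bs k)) ξ
        ≤ Real.exp (u k m) * ∫ z in smallFieldOn (shrink L m w : Set (B1Eq324BenfattoLemma.Site d)) ((Is k).image fun x => x + τ k) (bs k),
          Real.exp (psi1p s D κ (shiftCoef (as k) (-τ k)) L w v m z + psi2 s D κ (shiftCoef (as k) (-τ k)) L w m z)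
            ∂condField d α β (((Cs k).image fun x => x + τ k) ∪ corridors L w (Bs k)) ξ)
    (hsep : ∀ j j' : Fin (d + 1), j ≠ j' → ∀ (i : Fin d) (q : ℤ),
      (2 * (2 * w + v : ℕ) : ℤ) ≤ |(-(∑ i' ∈ Finset.range ((j : ℕ) + 1), τ i')) i - (-(∑ i' ∈ Finset.range ((j' : ℕ) + 1), τ i')) i - q * L|) :
    ∫ z, cutoffBoltzmann (hamiltonian s D κ (as 0) (Js 0)) (Is 0) (γ * bs 0) z ∂condField d α β (Cs 0) (zs 0) ≤
      Real.exp (∑ k ∈ Finset.range (d + 1),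
          (s1Const s D d κ * A * (γ * bs k) ^ D * Real.exp (-(κ / 4 * w)) * (Js k).card
            + s1Const s D d κ * A * bs k ^ D *
              (Real.exp (-(κ / 4 * w)) * (corridorsBar L w v (Bs k)).card + Real.exp (-(κ / 4 * v)) * ((Bs k).card * (L : ℝ) ^ d))
            + ∑ m ∈ Bs k, u k m)) := by
  haveI : IsProbabilityMeasure (condField d α β (Cs (d + 1)) (zs (d + 1))) := isProbabilityMeasure_condField hα hβ _ _
  have hchain := upperPavementChainCond hα hβ hκ hL hw hv hγ hA0 hsupp hA hJI hrecJ hrecI hreca hrecC hrecz hrecb hb hγb hB u hbox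
    (s := s) (D := D)
  have hJe : Js (d + 1) = ∅ := chain_eq_empty_of_sep hL hrecJ hsep
  have hterm : ∫ z, cutoffBoltzmann (hamiltonian s D κ (as (d + 1)) (Js (d + 1))) (Is (d + 1)) (γ * bs (d + 1)) z
      ∂condField d α β (Cs (d + 1)) (zs (d + 1)) ≤ 1 := by
    rw [integral_cutoffBoltzmann_condField_of_eq_empty hJe]
    exact measureReal_le_one
  refine hchain.trans ?_
  have h := mul_le_mul_of_nonneg_left hterm (Real.exp_pos (∑ k ∈ Finset.range (d + 1),
          (s1Const s D d κ * A * (γ * bs k) ^ D * Real.exp (-(κ / 4 * w)) * (Js k).card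
            + s1Const s D d κ * A * bs k ^ D *
              (Real.exp (-(κ / 4 * w)) * (corridorsBar L w v (Bs k)).card + Real.exp (-(κ / 4 * v)) * ((Bs k).card * (L : ℝ) ^ d))
            + ∑ m ∈ Bs k, u k m))).le
  rwa [mul_one] at h

end Chain

/-! ## §4  The conditioning set along the chain: far from `J`, and either small or nothing to prove -/

section Conditioning

variable {α β : ℝ} {s D : ℕ} {κ : ℝ} {L w v : ℕ}

/-- `d(Δ_{x+τ}, I + τ) = d(Δ_x, I)`: the distance to a region is translation invariant. [cite: BenfattoEtAl1978, after (2.3) p.146, §5 p.159] -/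
theorem distToRegion_image_add (I : Finset (B1Eq324BenfattoLemma.Site d)) (x τ : B1Eq324BenfattoLemma.Site d) :
    distToRegion (I.image fun y => y + τ) (x + τ) = distToRegion I x := by
  by_cases hI : I.Nonempty
  · have hI' : (I.image fun y => y + τ).Nonempty := hI.image _
    rw [distToRegion, dif_pos hI', distToRegion, dif_pos hI, Finset.inf'_image]
    congr 1
    funext y
    simp only [Function.comp_apply, cubeDist_add_right]
  · have hI' : ¬ (I.image fun y => y + τ).Nonempty := by rwa [Finset.image_nonempty]
    rw [distToRegion, dif_neg hI', distToRegion, dif_neg hI]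

/-- **The conditioning values move with the frame**: `z̄` obeys `|z̄_c| ≤ c₀(1 + d(Δ_c, I))` on `C` iff `z̄∘(· − τ)` obeys it on `C + τ` relative to
`I + τ`. [cite: BenfattoEtAl1978, p.159 «assuming |z_Δ| ≦ b(1+d(Δ,I)) ∀Δ ∈ C»] -/
theorem mem_smallFieldOn_frame {C I : Finset (B1Eq324BenfattoLemma.Site d)} {ζ : B1Eq324BenfattoLemma.Site d → ℝ} {c : ℝ}
    (h : ζ ∈ smallFieldOn (C : Set (B1Eq324BenfattoLemma.Site d)) I c) (τ : B1Eq324BenfattoLemma.Site d) :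
    (fun y => ζ (y - τ)) ∈ smallFieldOn ((C.image fun x => x + τ : Finset (B1Eq324BenfattoLemma.Site d)) : Set (B1Eq324BenfattoLemma.Site d))
      (I.image fun x => x + τ) c := by
  intro y hy
  obtain ⟨x, hx, rfl⟩ := Finset.mem_image.mp (Finset.mem_coe.mp hy)
  dsimp only
  rw [add_sub_cancel_right, distToRegion_image_add]
  exact h x (Finset.mem_coe.mpr hx)

/-- **Print's distance condition moves with the frame**: «C at distance b³ from J» is preserved by translating both and by shrinking `J`.
[cite: BenfattoEtAl1978, Lemma p.152 «C be … at distance b³ from J», §5 p.159] -/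
theorem far_frame {C J : Finset (B1Eq324BenfattoLemma.Site d)} {R : ℝ} (h : ∀ x ∈ C, ∀ y ∈ J, R ≤ cubeDist x y)
    (τ : B1Eq324BenfattoLemma.Site d) {J' : Finset (B1Eq324BenfattoLemma.Site d)} (hJ' : J' ⊆ J.image fun y => y + τ) :
    ∀ x ∈ C.image (fun x => x + τ), ∀ y ∈ J', R ≤ cubeDist x y := by
  intro x hx y hy
  obtain ⟨x₀, hx₀, rfl⟩ := Finset.mem_image.mp hx
  obtain ⟨y₀, hy₀, rfl⟩ := Finset.mem_image.mp (hJ' hy)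
  rw [cubeDist_add_right]
  exact h x₀ hx₀ y₀ hy₀

/-- **Along the chain**: the distance condition `d(C_k, J_k) ≥ R` and the smallness of the conditioning values `z̄_k ∈ SF(C_k, I_k, c₀)` propagate
(`C_{k+1} = C_k + τ_k`, `z̄_{k+1} = z̄_k∘(· − τ_k)`, `J_{k+1} ⊆ J_k + τ_k`, `I_{k+1} = I_k + τ_k`). [cite: BenfattoEtAl1978, Lemma p.152, §5 p.159] -/
theorem chain_far_small {Js Is Bs Cs : ℕ → Finset (B1Eq324BenfattoLemma.Site d)} {zs : ℕ → B1Eq324BenfattoLemma.Site d → ℝ}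
    {τ : ℕ → B1Eq324BenfattoLemma.Site d} {n : ℕ} {R c₀ : ℝ}
    (hfar : ∀ x ∈ Cs 0, ∀ y ∈ Js 0, R ≤ cubeDist x y)
    (hsmall : zs 0 ∈ smallFieldOn (Cs 0 : Set (B1Eq324BenfattoLemma.Site d)) (Is 0) c₀)
    (hrecJ : ∀ k < n, Js (k + 1) = (Js k).image (fun x => x + τ k) ∩ corridorsBar L w v (Bs k))
    (hrecI : ∀ k < n, Is (k + 1) = (Is k).image fun x => x + τ k)
    (hrecC : ∀ k < n, Cs (k + 1) = (Cs k).image fun x => x + τ k)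
    (hrecz : ∀ k < n, zs (k + 1) = fun y => zs k (y - τ k)) :
    ∀ k ≤ n, (∀ x ∈ Cs k, ∀ y ∈ Js k, R ≤ cubeDist x y) ∧
      zs k ∈ smallFieldOn (Cs k : Set (B1Eq324BenfattoLemma.Site d)) (Is k) c₀ := by
  intro k
  induction k with
  | zero => exact fun _ => ⟨hfar, hsmall⟩
  | succ k ih =>
    intro hk
    have hk' : k < n := Nat.lt_of_succ_le hk
    obtain ⟨h1, h2⟩ := ih hk'.le
    refine ⟨?_, ?_⟩
    · rw [hrecC k hk', hrecJ k hk']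
      exact far_frame h1 (τ k) Finset.inter_subset_left
    · rw [hrecC k hk', hrecz k hk', hrecI k hk']
      exact mem_smallFieldOn_frame h2 (τ k)

/-- **A far conditioning set misses every tessera meeting `J`**: if `d(Δ_x, Δ_y) ≥ R` for `x ∈ C`, `y ∈ J`, and `R > √d·(L − 1)` (two sites of one
tessera of side `L` are within cube distance `√d(L−1)` of each other), then `C ∩ □_m = ∅` for every `□_m` meeting `J` (print: `L ≈ b²`, `R = b³`). [cite: BenfattoEtAl1978, Lemma p.152 «at distance b³ from J», (5.7) p.154] -/
theorem disjoint_box_of_far {C J : Finset (B1Eq324BenfattoLemma.Site d)} {R : ℝ} (hfar : ∀ x ∈ C, ∀ y ∈ J, R ≤ cubeDist x y)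
    (hL : 0 < L) (hR : Real.sqrt d * ((L : ℝ) - 1) < R) {m : B1Eq324BenfattoLemma.Site d} (hm : m ∈ J.image (boxIndex L)) :
    Disjoint C (box L m) := by
  obtain ⟨y, hy, rfl⟩ := Finset.mem_image.mp hm
  rw [Finset.disjoint_left]
  intro x hxC hxb
  have hyb : y ∈ box L (boxIndex L y) := mem_box_boxIndex hL y
  have hL1 : (0 : ℝ) ≤ (L : ℝ) - 1 := by
    have : (1 : ℝ) ≤ L := by exact_mod_cast hL
    linarith
  have hcoord : ∀ j, max (|((x j : ℝ) - (y j : ℝ))| - 1) 0 ≤ (L : ℝ) - 1 := by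
    intro j
    obtain ⟨hx1, hx2⟩ := (mem_box_iff.mp hxb) j
    obtain ⟨hy1, hy2⟩ := (mem_box_iff.mp hyb) j
    have h1 : (x j : ℝ) - (y j : ℝ) ≤ (L : ℝ) - 1 := by
      have : x j - y j ≤ (L : ℤ) - 1 := by linarith
      exact_mod_cast this
    have h2 : (y j : ℝ) - (x j : ℝ) ≤ (L : ℝ) - 1 := by
      have : y j - x j ≤ (L : ℤ) - 1 := by linarith
      exact_mod_cast this
    have habs : |((x j : ℝ) - (y j : ℝ))| ≤ (L : ℝ) - 1 := abs_sub_le_iff.mpr ⟨h1, h2⟩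
    exact max_le (by linarith) hL1
  have hle : cubeDist x y ≤ Real.sqrt d * ((L : ℝ) - 1) := by
    unfold cubeDist
    have hsum : ∑ j, max (|((x j : ℝ) - (y j : ℝ))| - 1) 0 ^ 2 ≤ (d : ℝ) * ((L : ℝ) - 1) ^ 2 := by
      calc ∑ j, max (|((x j : ℝ) - (y j : ℝ))| - 1) 0 ^ 2 ≤ ∑ _j : Fin d, ((L : ℝ) - 1) ^ 2 :=
            Finset.sum_le_sum fun j _ => pow_le_pow_left₀ (le_max_right _ _) (hcoord j) 2
        _ = (d : ℝ) * ((L : ℝ) - 1) ^ 2 := by rw [Finset.sum_const, Finset.card_univ, Fintype.card_fin, nsmul_eq_mul]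
    calc Real.sqrt (∑ j, max (|((x j : ℝ) - (y j : ℝ))| - 1) 0 ^ 2) ≤ Real.sqrt ((d : ℝ) * ((L : ℝ) - 1) ^ 2) := Real.sqrt_le_sqrt hsum
      _ = Real.sqrt d * ((L : ℝ) - 1) := by rw [Real.sqrt_mul (Nat.cast_nonneg d), Real.sqrt_sq hL1]
  exact absurd (hfar x hxC y hy) (not_le.mpr (hle.trans_lt hR))

/-- **The conditioning set of the two-stage law misses the box variables**: for `B` = the tesserae meeting `J` (so `□_m ∩ J ≠ ∅` for `m ∈ B`) and `C` far
from `J`, `C ∪ Γ₁(B)` is disjoint from `□′_m ∪ Γ₂(□_m) = shrink w` (`…Sect5Boxes.disjoint_corridors_shrink` for `Γ₁`) — the hypothesis `hΓd` of the per-box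
supplier `…PerBoxAppD.perBox_condField_appD` at `Γ := C ∪ Γ₁`. [cite: BenfattoEtAl1978, Lemma p.152, (5.8) p.155, (5.13) p.155] -/
theorem disjoint_union_corridors_shrink_of_far {C J : Finset (B1Eq324BenfattoLemma.Site d)} {R : ℝ}
    (hfar : ∀ x ∈ C, ∀ y ∈ J, R ≤ cubeDist x y) (hL : 0 < L) (hR : Real.sqrt d * ((L : ℝ) - 1) < R) (w : ℕ)
    {m : B1Eq324BenfattoLemma.Site d} (hm : m ∈ J.image (boxIndex L)) :
    Disjoint (C ∪ corridors L w (J.image (boxIndex L))) (shrink L m w) := by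
  rw [Finset.disjoint_union_left]
  exact ⟨Finset.disjoint_of_subset_right (shrink_subset_box L m w) (disjoint_box_of_far hfar hL hR hm),
    disjoint_corridors_shrink hL w _ m⟩

end Conditioning

/-! ## §5  (4.6) for one choice of everything, modulo the identification and the ledger -/

section Ineq46

variable {α β : ℝ} {s D t : ℕ} {κ : ℝ} {L w v : ℕ} {γ : ℝ} {S ρ₁ ρ₂ ρ₃ ρ₄ : ℝ}

/-- **(4.6) FOR ONE CHOICE OF EVERYTHING, FROM THE UPPER PAVEMENT CHAIN** — «(5.12) can be bounded above by the r.h.s. of (5.35) with b replaced by γ⁻¹b»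
iterated, with the two remaining obligations DISPLAYED.  Data: `a` and an upper chain `(J_k, I_k, A_k, C_k, z̄_k, b_k, τ_k, B_k)_{k≤d+1}` starting at
`(J, I, A_0, C, z̄, b_0)` with `γb_0 = b` (the cut-off of (4.6)), ANY `z̄`, and `A_0` a clipped twin of `a` on `J` (`hH`), obeying the recursion of
`upperPavementChainCond`, with per-box UPPER bounds (exponents `u_k(□)`, for data small on `C_k ∪ Γ₁`) and suitably separated displacements; PLUS (O1′)
per step `k ≤ d`:
`Σ_{□∈B_k}u_k(□) ≤ cumulantSum P̂₀ H^{A_k(·−τ_k)}_{J_k+τ_k} t − cumulantSum P̂₀ H^{A_k(·−τ_k)}_{Γ̄₁(B_k)} t + idErr_k`; PLUS (O2′)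
`Σ_{k≤d}(err₅₁₁(k) + err₅₃₄(k) + idErr_k) ≤ |I|·errTerm S ρ₁ ρ₂ ρ₃ ρ₄ A b t`, `A ≡ coefSup s D a J`.  THEN `Ineq46 d α β t D s ϰ S ρ₁ ρ₂ ρ₃ ρ₄ b I J C a z̄`:
`∫Π_Δχ̂_Δ e^{H_J} dP̂₀(·|z̄_C) ≤ exp([Σ_{k=1}^{t}ℰ̂₀^T(H_J;k)/k!] + |I|·S(…))` — the truncated expectations w.r.t. the UNCONDITIONAL `P̂₀` (Remark 1), by the
telescope `…PavementChain.cumulantSum_chain_telescope_of_eq_empty`. [cite: BenfattoEtAl1978, Lemma (4.6) p.152 + Remark 1; §5 (5.36) p.159] -/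
theorem ineq46_of_chain (hα : 0 < α) (hβ : 0 < β) (hκ : 0 < κ) (hL : 0 < L) (hw : 1 ≤ w) (hv : v ≤ w) (hγ : γ ≤ 1)
    (a : Coef d) {b : ℝ} {Js Is Bs Cs : ℕ → Finset (B1Eq324BenfattoLemma.Site d)} {as : ℕ → Coef d} {zs : ℕ → B1Eq324BenfattoLemma.Site d → ℝ}
    {bs : ℕ → ℝ} {τ : ℕ → B1Eq324BenfattoLemma.Site d} (hb0 : γ * bs 0 = b)
    (hH : ∀ R : Finset (B1Eq324BenfattoLemma.Site d), R ⊆ Js 0 → ∀ z, hamiltonian s D κ (as 0) R z = hamiltonian s D κ a R z)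
    (hsupp : CoefSupportedIn (as 0) (Js 0))
    (hA : ∀ (p : ℕ) (Δ : Fin p → B1Eq324BenfattoLemma.Site d) (nn : Fin p → ℕ), |as 0 p Δ nn| ≤ coefSup s D a (Js 0)) (hJI : Js 0 ⊆ Is 0)
    (hrecJ : ∀ k < d + 1, Js (k + 1) = (Js k).image (fun x => x + τ k) ∩ corridorsBar L w v (Bs k))
    (hrecI : ∀ k < d + 1, Is (k + 1) = (Is k).image fun x => x + τ k)
    (hreca : ∀ k < d + 1, as (k + 1) = restrictCoef (shiftCoef (as k) (-τ k)) (corridorsBar L w v (Bs k)))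
    (hrecC : ∀ k < d + 1, Cs (k + 1) = (Cs k).image fun x => x + τ k)
    (hrecz : ∀ k < d + 1, zs (k + 1) = fun y => zs k (y - τ k))
    (hrecb : ∀ k < d + 1, γ * bs (k + 1) = bs k) (hb : ∀ k < d + 1, 1 ≤ bs k) (hγb : ∀ k < d + 1, 1 ≤ γ * bs k)
    (hB : ∀ k < d + 1, ((Js k).image fun x => x + τ k).image (boxIndex L) ⊆ Bs k)
    (u : ℕ → B1Eq324BenfattoLemma.Site d → ℝ)
    (hbox : ∀ k < d + 1, ∀ m ∈ Bs k, ∀ ξ : B1Eq324BenfattoLemma.Site d → ℝ,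
      ξ ∈ smallFieldOn ((((Cs k).image fun x => x + τ k) ∪ corridors L w (Bs k) : Finset (B1Eq324BenfattoLemma.Site d)) :
        Set (B1Eq324BenfattoLemma.Site d)) ((Is k).image fun x => x + τ k) (γ * bs k) →
      ∫ z in smallFieldOn (shrink L m w : Set (B1Eq324BenfattoLemma.Site d)) ((Is k).image fun x => x + τ k) (bs k),
          Real.exp (psiBox s D κ (shiftCoef (as k) (-τ k)) L w m z)
            ∂condField d α β (((Cs k).image fun x => x + τ k) ∪ corridors L w (Bs k)) ξ
        ≤ Real.exp (u k m) * ∫ z in smallFieldOn (shrink L m w : Set (B1Eq324BenfattoLemma.Site d)) ((Is k).image fun x => x + τ k) (bs k),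
          Real.exp (psi1p s D κ (shiftCoef (as k) (-τ k)) L w v m z + psi2 s D κ (shiftCoef (as k) (-τ k)) L w m z)
            ∂condField d α β (((Cs k).image fun x => x + τ k) ∪ corridors L w (Bs k)) ξ)
    (hsep : ∀ j j' : Fin (d + 1), j ≠ j' → ∀ (i : Fin d) (q : ℤ),
      (2 * (2 * w + v : ℕ) : ℤ) ≤ |(-(∑ i' ∈ Finset.range ((j : ℕ) + 1), τ i')) i - (-(∑ i' ∈ Finset.range ((j' : ℕ) + 1), τ i')) i - q * L|)
    (idErr : ℕ → ℝ)
    (hE : ∀ k < d + 1, ∑ m ∈ Bs k, u k m ≤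
      cumulantSum (P0 d α β) (hamiltonian s D κ (shiftCoef (as k) (-τ k)) ((Js k).image fun x => x + τ k)) t
        - cumulantSum (P0 d α β) (hamiltonian s D κ (shiftCoef (as k) (-τ k)) (corridorsBar L w v (Bs k))) t + idErr k)
    (hledger : ∑ k ∈ Finset.range (d + 1),
        (s1Const s D d κ * coefSup s D a (Js 0) * (γ * bs k) ^ D * Real.exp (-(κ / 4 * w)) * (Js k).card
          + s1Const s D d κ * coefSup s D a (Js 0) * bs k ^ D *
            (Real.exp (-(κ / 4 * w)) * (corridorsBar L w v (Bs k)).card + Real.exp (-(κ / 4 * v)) * ((Bs k).card * (L : ℝ) ^ d))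
          + idErr k)
        ≤ (Is 0).card * errTerm S ρ₁ ρ₂ ρ₃ ρ₄ (coefSup s D a (Js 0)) b t) :
    Ineq46 d α β t D s κ S ρ₁ ρ₂ ρ₃ ρ₄ b (Is 0) (Js 0) (Cs 0) a (zs 0) := by
  unfold Ineq46
  have hA0 : 0 ≤ coefSup s D a (Js 0) := coefSup_nonneg s D a (Js 0)
  have hchain := upperPavementChainCond_le_exp hα hβ hκ hL hw hv hγ hA0 hsupp hA hJI hrecJ hrecI hreca hrecC hrecz hrecb hb hγb hB u hbox hsep
    (s := s) (D := D)
  have hJe : Js (d + 1) = ∅ := chain_eq_empty_of_sep hL hrecJ hsep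
  have htel := cumulantSum_chain_telescope_of_eq_empty hα hβ hsupp hrecJ hreca hJe t (s := s) (D := D) (κ := κ)
  have hfun : hamiltonian s D κ (as 0) (Js 0) = hamiltonian s D κ a (Js 0) := funext (hH (Js 0) subset_rfl)
  rw [hfun, hb0] at hchain
  rw [hfun] at htel
  refine hchain.trans ?_
  rw [Real.exp_le_exp]
  have hO1 : ∑ k ∈ Finset.range (d + 1), ∑ m ∈ Bs k, u k m ≤ ∑ k ∈ Finset.range (d + 1),
      (cumulantSum (P0 d α β) (hamiltonian s D κ (shiftCoef (as k) (-τ k)) ((Js k).image fun x => x + τ k)) t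
        - cumulantSum (P0 d α β) (hamiltonian s D κ (shiftCoef (as k) (-τ k)) (corridorsBar L w v (Bs k))) t + idErr k) :=
    Finset.sum_le_sum fun k hk => hE k (Finset.mem_range.mp hk)
  rw [Finset.sum_add_distrib, htel] at hO1
  have hsplit : ∑ k ∈ Finset.range (d + 1),
      (s1Const s D d κ * coefSup s D a (Js 0) * (γ * bs k) ^ D * Real.exp (-(κ / 4 * w)) * (Js k).card
        + s1Const s D d κ * coefSup s D a (Js 0) * bs k ^ D *
          (Real.exp (-(κ / 4 * w)) * (corridorsBar L w v (Bs k)).card + Real.exp (-(κ / 4 * v)) * ((Bs k).card * (L : ℝ) ^ d))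
        + ∑ m ∈ Bs k, u k m)
      = ∑ k ∈ Finset.range (d + 1),
          (s1Const s D d κ * coefSup s D a (Js 0) * (γ * bs k) ^ D * Real.exp (-(κ / 4 * w)) * (Js k).card
            + s1Const s D d κ * coefSup s D a (Js 0) * bs k ^ D *
              (Real.exp (-(κ / 4 * w)) * (corridorsBar L w v (Bs k)).card + Real.exp (-(κ / 4 * v)) * ((Bs k).card * (L : ℝ) ^ d)))
        + ∑ k ∈ Finset.range (d + 1), ∑ m ∈ Bs k, u k m := by
    rw [← Finset.sum_add_distrib]
  rw [hsplit]
  have hsum3 : ∑ k ∈ Finset.range (d + 1),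
      (s1Const s D d κ * coefSup s D a (Js 0) * (γ * bs k) ^ D * Real.exp (-(κ / 4 * w)) * (Js k).card
        + s1Const s D d κ * coefSup s D a (Js 0) * bs k ^ D *
          (Real.exp (-(κ / 4 * w)) * (corridorsBar L w v (Bs k)).card + Real.exp (-(κ / 4 * v)) * ((Bs k).card * (L : ℝ) ^ d))
        + idErr k)
      = ∑ k ∈ Finset.range (d + 1),
          (s1Const s D d κ * coefSup s D a (Js 0) * (γ * bs k) ^ D * Real.exp (-(κ / 4 * w)) * (Js k).card
            + s1Const s D d κ * coefSup s D a (Js 0) * bs k ^ D *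
              (Real.exp (-(κ / 4 * w)) * (corridorsBar L w v (Bs k)).card + Real.exp (-(κ / 4 * v)) * ((Bs k).card * (L : ℝ) ^ d)))
        + ∑ k ∈ Finset.range (d + 1), idErr k := by
    rw [← Finset.sum_add_distrib]
  rw [hsum3] at hledger
  linarith

end Ineq46

end Literature.MathematicalPhysics.QuantumFieldTheory.Balaban1983to89.B1Eq324BenfattoSect5PavementChainUpper

end
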